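import Literature.NumberTheory.EllipticCurves.IsogenyHasCMBaseChangeProofs
import Literature.NumberTheory.EllipticCurves.ComplexMultiplicationHasCMThirteenProofs
import HarnessLib

/-!
# Geometric complex multiplication ascends along base change; CM of the thirteen rational
# CM `j`-invariants over every field of characteristic zero

Topic `NumberTheory/EllipticCurves`; theorem-only `Proofs` companion of the prelude
`Literature.NumberTheory.EllipticCurves.Isogeny` (`WeierstrassCurve.HasCM`: `End_{K̄}(E) ≠ ℤ`) and of
`IsogenyHasCMBaseChangeProofs` (which proves the DESCENT `HasCM.of_baseChange`:
`(W.baseChange L).HasCM → W.HasCM`).  Nothing is defined, no named fact is introduced.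

* `WeierstrassCurve.isAlgebraicOn_conj_of_algEquiv` — the forward transport: an algebraic additive
  map of `E(K̄)`, conjugated to `E_L(L̄)` along a `K`-isomorphism `K̄ ≃ L̄`, is algebraic (mirror of
  the tree's `isAlgebraicOn_conj_symm_of_algEquiv`);
* `WeierstrassCurve.HasCM.baseChange` — **ASCENT: if `E` has complex multiplication over `K̄` then
  `E_L` has complex multiplication over `L̄`**, for every algebraic extension `L/K` (Silverman,
  *AEC*, III.§4 and C.11: `End(E)` is attached to `E/K̄`, and `K̄ ≅ L̄` over `K`);
  `WeierstrassCurve.hasCM_baseChange_iff` — the two directions together;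
* `WeierstrassCurve.hasCM_of_j_eq_of_mem_cmJInvariants` — **an elliptic curve over any field `K`
  of characteristic `0` algebraic over `ℚ` (e.g. a number field) whose `j`-invariant is one of the
  thirteen rational CM values `cmJInvariants` has (geometric) complex multiplication**: the tree proves the
  thirteen cases over `ℚ` (`hasCM_of_j_mem_cmJInvariants`, `ComplexMultiplicationHasCMThirteenProofs`);
  ascend the CM of a `ℚ`-model to `K` and transport along `j` (`hasCM_iff_of_j_eq`, *AEC* III.1.4(b));
  the named corollaries `hasCM_of_j_eq_neg3375_of_algebraic`, `hasCM_of_j_eq_16581375_of_algebraic`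
  (CM discriminants `-7`, `-28`) are the two cases met on the modular curve `X(H12,b7)` of the
  F-L1 census (cell `lg-quartmod`, THEOREM Z).

## References

* [SilvermanAEC2009] J. H. Silverman, *The Arithmetic of Elliptic Curves*, 2nd ed., GTM 106 (2009),
  III.1.4(b), III.§4 (the ring `End(E)`), Remark III.4.3, App. C §11, Examples 11.3.1–11.3.2.
* [SilvermanATAEC1994] J. H. Silverman, *Advanced Topics*, GTM 151 (1994), App. A §3 (the thirteen
  rational CM `j`-invariants).
* J. S. Milne, *Fields and Galois Theory*, §7 (uniqueness of algebraic closures). [folklore]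

## Design

`noncomputable section`, `open scoped Classical`, one universe `u` (`K L : Type u`, as in the
prelude and in `IsogenyHasCMBaseChangeProofs`); the rational-`j` corollaries are therefore stated
for fields `K : Type` (universe `0`, where `ℚ` lives) — enough for number fields `K : Type`, the
only consumers (route `Langlands/SqrtFiveQuarticCovers`).
-/

noncomputable section

open scoped Classical

universe u

namespace WeierstrassCurve

open Literature.NumberTheory.GaloisRepresentations

/-! ## Forward transport of algebraic maps along `K̄ ≃ L̄` -/

section Transport

variable {K : Type u} [Field K] {W : WeierstrassCurve K} {L : Type u} [Field L] [Algebra K L]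

/-- **An algebraic additive map of `E(K̄)`, conjugated forward to `E_L(L̄)` along `K̄ ≃ L̄`, is
algebraic.**  Let `ι : K̄ ≃ₐ[K] L̄` and `e : E(K̄) ≃+ E_L(L̄)` be `Affine.Point.map ι` on points.  If
`g : E(K̄) → E(K̄)` agrees off a finite set with `(P₁/Q₁, P₂/Q₂)`, `Pᵢ, Qᵢ ∈ K̄[x, y]`, then
`e ∘ g ∘ e⁻¹` agrees off a finite set with `(P₁^ι/Q₁^ι, P₂^ι/Q₂^ι)`.  Silverman, *AEC*, III.§4
(`End(E)` is attached to `E/K̄`: an isogeny is a rational map with `K̄`-coefficients, Remark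
III.4.3); mirror of the tree's `isAlgebraicOn_conj_symm_of_algEquiv`.
[cite: SilvermanAEC2009, III.§4 (the ring End(E)) and Remark III.4.3] -/
theorem isAlgebraicOn_conj_of_algEquiv (ι : AlgebraicClosure K ≃ₐ[K] AlgebraicClosure L)
    (e : W.geomPoints ≃+ (W.baseChange L).geomPoints)
    (he : ∀ P, e P = Affine.Point.map (W' := W)
      (ι : AlgebraicClosure K →ₐ[K] AlgebraicClosure L) P)
    {g : W.geomPoints →+ W.geomPoints} (hg : IsAlgebraicOn W W g) :
    IsAlgebraicOn (W.baseChange L) (W.baseChange L)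
      ((e.toAddMonoidHom.comp g).comp e.symm.toAddMonoidHom) := by
  set φ : AlgebraicClosure K →+* AlgebraicClosure L :=
    (ι : AlgebraicClosure K →+* AlgebraicClosure L) with hφ
  have hφx : ∀ x, φ x = ι x := fun _ ↦ rfl
  -- evaluation of `q^ι` at `(ι x, ι y)` is `ι` of the evaluation of `q` at `(x, y)`
  have heval : ∀ (q : MvPolynomial (Fin 2) (AlgebraicClosure K)) (x y : AlgebraicClosure K),
      MvPolynomial.eval ![ι x, ι y] (q.map φ) = ι (MvPolynomial.eval ![x, y] q) := fun q x y ↦ by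
    rw [← hφx x, ← hφx y]
    exact eval_map_ringHom_fin_two φ q x y
  obtain ⟨P₁, Q₁, P₂, Q₂, hfin⟩ := hg
  refine ⟨P₁.map φ, Q₁.map φ, P₂.map φ, Q₂.map φ, ?_⟩
  refine (hfin.image e).subset fun Q hQ ↦ ?_
  refine ⟨e.symm Q, fun hP' ↦ hQ ?_, e.apply_symm_apply Q⟩
  -- transport the agreement of `g` at `P = e⁻¹ Q` forward to `Q`
  obtain ⟨x, y, h, hPeq, hQ₁, hQ₂, h', hgP⟩ := hP'
  have hQeq : Q = e (.some x y h) := by rw [← hPeq, e.apply_symm_apply]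
  have hι3 : ((W.baseChange L).baseChange (AlgebraicClosure L)).toAffine.Nonsingular (ι x) (ι y) :=
    (Affine.baseChange_nonsingular (W := W)
      (f := (ι : AlgebraicClosure K →ₐ[K] AlgebraicClosure L)) ι.injective x y).mpr h
  have hQeq' : Q = .some (ι x) (ι y) hι3 := by
    rw [hQeq, he, Affine.Point.map_some]
    rfl
  -- the affine coordinates of `g P`
  set a : AlgebraicClosure K :=
    MvPolynomial.eval ![x, y] P₁ / MvPolynomial.eval ![x, y] Q₁ with ha
  set b : AlgebraicClosure K :=
    MvPolynomial.eval ![x, y] P₂ / MvPolynomial.eval ![x, y] Q₂ with hb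
  have hab : (W.baseChange (AlgebraicClosure K)).toAffine.Nonsingular a b := h'
  have h3 : ((W.baseChange L).baseChange (AlgebraicClosure L)).toAffine.Nonsingular (ι a) (ι b) :=
    (Affine.baseChange_nonsingular (W := W)
      (f := (ι : AlgebraicClosure K →ₐ[K] AlgebraicClosure L)) ι.injective a b).mpr hab
  have hx' : MvPolynomial.eval ![ι x, ι y] (P₁.map φ) / MvPolynomial.eval ![ι x, ι y] (Q₁.map φ) =
      ι a := by
    rw [heval, heval, ha, map_div₀]
  have hy' : MvPolynomial.eval ![ι x, ι y] (P₂.map φ) / MvPolynomial.eval ![ι x, ι y] (Q₂.map φ) =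
      ι b := by
    rw [heval, heval, hb, map_div₀]
  have h3' : ((W.baseChange L).baseChange (AlgebraicClosure L)).toAffine.Nonsingular
      (MvPolynomial.eval ![ι x, ι y] (P₁.map φ) / MvPolynomial.eval ![ι x, ι y] (Q₁.map φ))
      (MvPolynomial.eval ![ι x, ι y] (P₂.map φ) / MvPolynomial.eval ![ι x, ι y] (Q₂.map φ)) := by
    rw [hx', hy']
    exact h3
  have h4 : e (.some a b hab) = .some (ι a) (ι b) h3 := by
    rw [he]
    rfl
  refine ⟨ι x, ι y, hι3, hQeq', ?_, ?_, h3', ?_⟩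
  · rw [heval]
    exact (_root_.map_ne_zero ι).mpr hQ₁
  · rw [heval]
    exact (_root_.map_ne_zero ι).mpr hQ₂
  · change e (g (e.symm Q)) = _
    have key : e (g (e.symm Q)) = .some (ι a) (ι b) h3 := by
      rw [hgP]
      exact h4
    rw [key]
    exact Affine.Point.some.congr_simp _ _ hx'.symm _ _ hy'.symm _

end Transport

/-! ## Complex multiplication over `K̄` ascends along base change -/

section HasCM

variable {K : Type u} [Field K] {W : WeierstrassCurve K} {L : Type u} [Field L] [Algebra K L]

/-- **Complex multiplication over `K̄` ascends to every algebraic extension.**  For an elliptic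
curve `E = W` over a field `K` and an algebraic extension `L/K`: if `E` has complex multiplication
over `K̄` (`W.HasCM`), then the base change `E_L` has complex multiplication over `L̄`
(`(W.baseChange L).HasCM`).  A non-scalar `ψ ∈ End_{K̄}(E)` is an algebraic additive map (the
tree's `mem_geomEndRing_iff_holds`, Silverman III.4); conjugated along `E(K̄) ≃ E_L(L̄)` (induced
by `K̄ ≃ₐ[K] L̄`, `absClosureEquiv`) it is an algebraic additive map of `E_L(L̄)`
(`isAlgebraicOn_conj_of_algEquiv`), i.e. an element of `End_{L̄}(E_L)`, and it is not `[n]`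
because conjugation fixes every `[n]`.  Together with the tree's descent `HasCM.of_baseChange`
this is the statement that complex multiplication is a property of `E` over an algebraic closure
(Silverman, *AEC*, III.§4, Remark III.4.3, and C.11).
[cite: SilvermanAEC2009, III.§4 (the ring End(E)) and Remark III.4.3] -/
theorem HasCM.baseChange [W.IsElliptic] [Algebra.IsAlgebraic K L] (hCM : W.HasCM) :
    (W.baseChange L).HasCM := by
  obtain ⟨ψ, hψ, hn⟩ := hCM
  set ι : AlgebraicClosure K ≃ₐ[K] AlgebraicClosure L := absClosureEquiv K L with hι
  -- the bijection of points `e : E(K̄) ≃+ E_L(L̄)` along `ι`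
  let e : W.geomPoints ≃+ (W.baseChange L).geomPoints :=
    AddEquiv.ofBijective
      (Affine.Point.map (W' := W) (ι : AlgebraicClosure K →ₐ[K] AlgebraicClosure L) :
        W.geomPoints →+ (W.baseChange L).geomPoints)
      ⟨Affine.Point.map_injective (W' := W) _, map_algEquiv_algebraicClosure_surjective W L ι⟩
  have he : ∀ P, e P = Affine.Point.map (W' := W)
      (ι : AlgebraicClosure K →ₐ[K] AlgebraicClosure L) P := fun _ ↦ rfl
  -- `ψ` is algebraic, hence so is its conjugate `φ = e ∘ ψ ∘ e⁻¹`
  have hψ0 : ψ ≠ 0 := fun h0 ↦ hn 0 (by rw [h0, Int.cast_zero])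
  have halg : IsAlgebraicOn W W ψ :=
    ((mem_geomEndRing_iff_holds (W := W) ψ).1 hψ).resolve_left hψ0
  let φ : AddMonoid.End (W.baseChange L).geomPoints :=
    (e.toAddMonoidHom.comp (ψ : W.geomPoints →+ W.geomPoints)).comp e.symm.toAddMonoidHom
  have hφ_apply : ∀ Q, φ Q = e (ψ (e.symm Q)) := fun _ ↦ rfl
  have hφalg : IsAlgebraicOn (W.baseChange L) (W.baseChange L) φ :=
    isAlgebraicOn_conj_of_algEquiv ι e he halg
  refine ⟨φ, Subring.subset_closure hφalg, fun n hφn ↦ hn n ?_⟩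
  -- if `e ψ e⁻¹ = [n]` then `ψ = e⁻¹ [n] e = [n]`
  have hφn' : ∀ Q, φ Q = n • Q := fun Q ↦
    (AddMonoid.End.ext_iff.1 hφn Q).trans (AddMonoid.End.intCast_apply n Q)
  refine AddMonoid.End.ext_iff.2 fun P ↦ ?_
  have hP : e (ψ P) = n • e P := by
    have h := hφn' (e P)
    rwa [hφ_apply, AddEquiv.symm_apply_apply] at h
  calc ψ P = e.symm (e (ψ P)) := (e.symm_apply_apply _).symm
    _ = e.symm (n • e P) := by rw [hP]
    _ = n • P := by rw [map_zsmul, AddEquiv.symm_apply_apply]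
    _ = (n : AddMonoid.End W.geomPoints) P := (AddMonoid.End.intCast_apply n P).symm

/-- **Complex multiplication is insensitive to algebraic base change** (both directions: the tree's
descent `HasCM.of_baseChange` and the ascent `HasCM.baseChange`).  Silverman, *AEC*, III.§4,
Remark III.4.3 and C.11. [cite: SilvermanAEC2009, III.§4 (the ring End(E)) and Remark III.4.3] -/
theorem hasCM_baseChange_iff [W.IsElliptic] [Algebra.IsAlgebraic K L] :
    (W.baseChange L).HasCM ↔ W.HasCM :=
  ⟨HasCM.of_baseChange, HasCM.baseChange⟩

end HasCM

/-! ## The thirteen rational CM `j`-invariants give CM over every algebraic extension of `ℚ` -/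

section RationalJ

variable {K : Type} [Field K] [CharZero K]

/-- `j` of the base change of a rational curve is the image of its rational `j` (plumbing).
[folklore] -/
private theorem j_baseChange_rat (V : WeierstrassCurve ℚ) [V.IsElliptic] :
    (V.baseChange K).j = ((V.j : ℚ) : K) := by
  simp only [WeierstrassCurve.baseChange, WeierstrassCurve.map_j, eq_ratCast]

/-- **CM of the thirteen rational CM `j`-invariants over any algebraic extension of `ℚ`.**  Let `K`
be a field of characteristic `0`, algebraic over `ℚ` (e.g. a number field), and `E/K` an elliptic
curve whose `j`-invariant is (the image in `K` of) one of the thirteen rational CM values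
`cmJInvariants` (`0, 1728, -3375, 8000, -32768, 54000, 287496, -884736, -12288000, 16581375,
-884736000, -147197952000, -262537412640768000`; Silverman, *Advanced Topics*, App. A §3).  Then
`E` has (geometric) complex multiplication: a rational model `V/ℚ` with `j(V) = j₀` has CM (the
tree's `hasCM_of_j_mem_cmJInvariants`, *AEC* C.11), hence so does `V_K` (`HasCM.baseChange`), and
`E ≅ V_K` over `K̄` since `j(E) = j(V_K)` (`hasCM_iff_of_j_eq`, *AEC* III.1.4(b)).
[cite: SilvermanAEC2009, App. C §11, Example 11.3.1–11.3.2] -/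
theorem hasCM_of_j_eq_of_mem_cmJInvariants [Algebra.IsAlgebraic ℚ K] (E : WeierstrassCurve K)
    [E.IsElliptic] {j₀ : ℚ} (hj₀ : j₀ ∈ cmJInvariants) (hj : E.j = (j₀ : K)) : E.HasCM := by
  -- a rational model with `j = j₀`: Mathlib's `ofJ j₀`, elliptic over `ℚ`
  obtain ⟨V, hVell, hVj⟩ : ∃ (V : WeierstrassCurve ℚ) (_ : V.IsElliptic), V.j = j₀ :=
    ⟨WeierstrassCurve.ofJ j₀, inferInstance, WeierstrassCurve.ofJ_j j₀⟩
  have hVCM : V.HasCM := hasCM_of_j_mem_cmJInvariants V (hVj ▸ hj₀)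
  have hVK : (V.baseChange K).HasCM := HasCM.baseChange (L := K) hVCM
  have hjj : E.j = (V.baseChange K).j := by rw [j_baseChange_rat, hVj, hj]
  exact (hasCM_iff_of_j_eq hjj).2 hVK

/-- **`j = -3375` (CM by `ℤ[(1 + √-7)/2]`, `D = -7`) over any algebraic extension of `ℚ`**: an
elliptic curve `E/K`, `K ⊇ ℚ` algebraic of characteristic `0`, with `j(E) = -3375` has complex
multiplication.  (Met on `X(H12,b7)` over `ℚ(√5)` at the CM point `(t,u) = (0,-7)` of the F-L1
census.) [cite: SilvermanAEC2009, App. C §11, Example 11.3.1–11.3.2] -/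
theorem hasCM_of_j_eq_neg3375_of_algebraic [Algebra.IsAlgebraic ℚ K] (E : WeierstrassCurve K)
    [E.IsElliptic] (hj : E.j = -3375) : E.HasCM :=
  hasCM_of_j_eq_of_mem_cmJInvariants E (j₀ := -3375) (by decide) (by rw [hj]; push_cast; ring)

/-- **`j = 16581375 = 255³` (CM by the order of conductor `2` in `ℚ(√-7)`, `D = -28`) over any
algebraic extension of `ℚ`**: an elliptic curve `E/K`, `K ⊇ ℚ` algebraic of characteristic `0`,
with `j(E) = 16581375` has complex multiplication.  (Met on `X(H12,b7)` over `ℚ(√5)` at the CM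
point `(t,u) = (-2,7)` of the F-L1 census.) [cite: SilvermanAEC2009, App. C §11, Example 11.3.1–11.3.2] -/
theorem hasCM_of_j_eq_16581375_of_algebraic [Algebra.IsAlgebraic ℚ K] (E : WeierstrassCurve K)
    [E.IsElliptic] (hj : E.j = 16581375) : E.HasCM :=
  hasCM_of_j_eq_of_mem_cmJInvariants E (j₀ := 16581375) (by decide) (by rw [hj]; push_cast; ring)

end RationalJ

end WeierstrassCurve

end
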